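import Summits.NavierStokesRegularity.NavierStokesRegularity.Theses.QuantisedSymmetry
import Summits.NavierStokesRegularity.NavierStokesRegularity.Theses.Blowup
import Summits.NavierStokesRegularity.NavierStokesRegularity.Theorems.QuantisedSymmetryPolyhedralTruncationBridge
import Summits.NavierStokesRegularity.NavierStokesRegularity.Theorems.QuantisedSymmetryLiouvilleKillsProfile
import Summits.NavierStokesRegularity.NavierStokesRegularity.Theorems.QuantisedSymmetryPolyhedralDssProfileExistsDominatesBlowupProfile
import Summits.NavierStokesRegularity.NavierStokesRegularity.Theorems.QuantisedSymmetryPolyhedralDssProfileExistsOfCell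
import HarnessLib

/-!
# Strategist sketch S19-g7 (independent census, family `s`) — crux `PolyhedralDssProfileExists`
# (X⁻, stmt-NavierStokesRegularity-1404), route `QuantisedSymmetry`

Kernel-checked companion of `STRATEGY-CENSUS-s19.md` (gen 7).  Nothing here is a new route item; the file
only CERTIFIES the logical lattice used in the census:

* §0  `notNSR_of_X` — X⁻ alone decides the summit negatively (the other two binders of `closes` are
  theorems), so any lossless replacement of X⁻ is itself a disproof of `NavierStokesRegularity`.
* §1  the two strictly-weaker-looking intermediates that the tree reaches from X⁻:
  `NotPolyhedralLiouville` (failure of the kill switch stmt-1405) and `Blowup.BlowupTypeIDssProfile`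
  (stmt-0155, failure of Tsai's Type-I (R)DSS Liouville conjecture).
* §2  the best typed decompositions found: the bridge split (D-B) and the Palais–Smale split (D-A′:
  approximate `G`-cells with vanishing Duhamel defect + compactness), each with its PROVED assembly.
  The census explains why in each split one piece still carries the whole crux.

No `sorry`.  Namespace per CRUX WORKFILES convention.
-/

set_option linter.dupNamespace false
set_option linter.unusedVariables false

namespace Summit.NavierStokesRegularity.NavierStokesRegularity.Cruxes.PolyhedralDssProfileExists.S19g7

open MeasureTheory Set Function Filter Topology
open Literature.Analysis.FluidPDE
open Summit.NavierStokesRegularity.NavierStokesRegularity.Theses.QuantisedSymmetry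

/-! ## §0  X⁻ alone decides the summit -/

/-- With `PolyhedralTruncationBridge` (p-proved, b834ed6c416d) and `ClayUniqueness` (proved) discharged,
the route's deciding theorem reads `X⁻ → ¬ NavierStokesRegularity`. -/
theorem notNSR_of_X (hX : PolyhedralDssProfileExists) : ¬ _root_.NavierStokesRegularity :=
  closes hX
    _root_.Summit.NavierStokesRegularity.NavierStokesRegularity.Theorems.quantisedSymmetry_polyhedralTruncationBridge_proof
    ClayUniqueness_holds

/-! ## §1  Strictly-weaker-looking intermediates reachable from X⁻ in the tree -/

/-- B1: failure of the polyhedral Type-I Liouville theorem (kill switch stmt-1405): some finite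
irreducible proper rotation group admits a nonzero equivariant BOUNDED ancient mild Type-I solution. -/
def NotPolyhedralLiouville : Prop := ¬ PolyhedralTypeILiouville

/-- X⁻ ⇒ B1 (contrapositive of the landed `LiouvilleKillsProfile`, stmt-1408). -/
theorem notPolyhedralLiouville_of_X (hX : PolyhedralDssProfileExists) : NotPolyhedralLiouville :=
  fun hL => _root_.Summit.NavierStokesRegularity.NavierStokesRegularity.Theorems.quantisedSymmetry_liouvilleKillsProfile_proof hL hX

/-- X⁻ ⇒ stmt-0155 (`Blowup.BlowupTypeIDssProfile` = failure of Tsai's Type-I (R)DSS Liouville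
conjecture), landed as `stub_dominatesBlowupProfile` (p156644). -/
theorem blowupProfile_of_X (hX : PolyhedralDssProfileExists) :
    _root_.Summit.NavierStokesRegularity.NavierStokesRegularity.Theses.Blowup.BlowupTypeIDssProfile :=
  _root_.Summit.NavierStokesRegularity.NavierStokesRegularity.Theorems.PolyhedralDssProfileExists.PolyhedralCell.stub_dominatesBlowupProfile hX

/-! ## §2  Typed decompositions

### D-B  bridge split `B1 ∧ (B1 → X⁻)` -/

/-- The closing lemma of the bridge split: a bounded equivariant Type-I ancient counterexample can be
upgraded to a DISCRETELY SELF-SIMILAR one (a "periodic-orbit closing lemma" for the Leray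
semiflow in the invariant sector).  Open; no engine (see census `## Decomposition`). -/
def ClosingLemma : Prop := NotPolyhedralLiouville → PolyhedralDssProfileExists

/-- Assembly of D-B (modus ponens; `trivial_seam`). -/
theorem X_of_bridgeSplit (h₁ : NotPolyhedralLiouville) (h₂ : ClosingLemma) :
    PolyhedralDssProfileExists :=
  h₂ h₁

/-! ### D-A′  Palais–Smale split: approximate `G`-cells with vanishing defect + compactness

`CellExists` is byte-for-byte the registered stub `stub_polyhedralCellExists` of line `polyhedral_cell`
(certified `↔ X⁻`, p156679).  `ApproxCellSeq` asks only for a NON-DEGENERATE sequence of approximate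
cells: every clause of the cell except the Duhamel identity, which holds up to a uniform defect
`ε n → 0`, plus uniform bounds (`M`) and a localised `L⁴` floor `δ` on a fixed ball (non-degeneracy /
tightness).  `CellCompactness` is the compactness half. -/

/-- Exact `G`-cell with `L⁴` datum on the model period (= registered stub `stub_polyhedralCellExists`). -/
def CellExists : Prop :=
  ∃ G : Subgroup (EuclideanSpace ℝ (Fin 3) ≃ₗᵢ[ℝ] EuclideanSpace ℝ (Fin 3)), Finite G ∧
    (∀ g ∈ G, LinearMap.det (g.toLinearEquiv : EuclideanSpace ℝ (Fin 3) →ₗ[ℝ] EuclideanSpace ℝ (Fin 3)) = 1) ∧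
    (∀ V : Submodule ℝ (EuclideanSpace ℝ (Fin 3)), (∀ g ∈ G, ∀ v ∈ V, g v ∈ V) → V = ⊥ ∨ V = ⊤) ∧
    ∃ c : ℝ, 1 < c ∧ ∃ v : ℝ → EuclideanSpace ℝ (Fin 3) → EuclideanSpace ℝ (Fin 3),
      (ContinuousOn (Function.uncurry v) (Set.Icc (-1 : ℝ) (-(c ^ 2)⁻¹) ×ˢ Set.univ) ∧
        (∃ M : ℝ, ∀ t ∈ Set.Icc (-1 : ℝ) (-(c ^ 2)⁻¹), ∀ x, ‖v t x‖ ≤ M) ∧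
        (∀ t ∈ Set.Icc (-1 : ℝ) (-(c ^ 2)⁻¹), IsWeaklyDivFree (v t)) ∧
        (∀ s t : ℝ, -1 ≤ s → s < t → t ≤ -(c ^ 2)⁻¹ → ∀ x,
          v t x = heatFlow (v s) (t - s) x - oseenDuhamel 1 s v v t x) ∧
        (∀ x, v (-(c ^ 2)⁻¹) x = c • v (-1) (c • x)) ∧
        (∀ g ∈ G, ∀ t ∈ Set.Icc (-1 : ℝ) (-(c ^ 2)⁻¹), ∀ x, v t (g x) = g (v t x))) ∧
      MemLp (v (-1)) 4 volume ∧ ¬ (v (-1) =ᵐ[volume] 0)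

/-- P1 (the ∃-half): a non-degenerate Palais–Smale sequence of approximate `G`-cells. -/
def ApproxCellSeq : Prop :=
  ∃ G : Subgroup (EuclideanSpace ℝ (Fin 3) ≃ₗᵢ[ℝ] EuclideanSpace ℝ (Fin 3)), Finite G ∧
    (∀ g ∈ G, LinearMap.det (g.toLinearEquiv : EuclideanSpace ℝ (Fin 3) →ₗ[ℝ] EuclideanSpace ℝ (Fin 3)) = 1) ∧
    (∀ V : Submodule ℝ (EuclideanSpace ℝ (Fin 3)), (∀ g ∈ G, ∀ v ∈ V, g v ∈ V) → V = ⊥ ∨ V = ⊤) ∧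
    ∃ c : ℝ, 1 < c ∧ ∃ M δ R : ℝ, 0 < δ ∧
    ∃ (v : ℕ → ℝ → EuclideanSpace ℝ (Fin 3) → EuclideanSpace ℝ (Fin 3)) (ε : ℕ → ℝ),
      Tendsto ε atTop (𝓝 0) ∧
      ∀ n, ContinuousOn (Function.uncurry (v n)) (Set.Icc (-1 : ℝ) (-(c ^ 2)⁻¹) ×ˢ Set.univ) ∧
        (∀ t ∈ Set.Icc (-1 : ℝ) (-(c ^ 2)⁻¹), ∀ x, ‖v n t x‖ ≤ M) ∧
        (∀ t ∈ Set.Icc (-1 : ℝ) (-(c ^ 2)⁻¹), IsWeaklyDivFree (v n t)) ∧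
        (∀ s t : ℝ, -1 ≤ s → s < t → t ≤ -(c ^ 2)⁻¹ → ∀ x,
          ‖v n t x - (heatFlow (v n s) (t - s) x - oseenDuhamel 1 s (v n) (v n) t x)‖ ≤ ε n) ∧
        (∀ x, v n (-(c ^ 2)⁻¹) x = c • v n (-1) (c • x)) ∧
        (∀ g ∈ G, ∀ t ∈ Set.Icc (-1 : ℝ) (-(c ^ 2)⁻¹), ∀ x, v n t (g x) = g (v n t x)) ∧
        MemLp (v n (-1)) 4 volume ∧ (∫ x, ‖v n (-1) x‖ ^ (4 : ℕ) ∂volume ≤ M) ∧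
        δ ≤ ∫ x in Metric.ball (0 : EuclideanSpace ℝ (Fin 3)) R, ‖v n (-1) x‖ ^ (4 : ℕ) ∂volume

/-- P2 (the compactness half): a non-degenerate Palais–Smale sequence of approximate `G`-cells
subconverges to an exact nontrivial `G`-cell.  Plausibly PROVABLE (interior parabolic regularisation,
transferred to the initial slice by the junction condition; Arzelà–Ascoli; dominated convergence in the
Oseen–Duhamel term; the `L⁴` floor on the fixed ball survives local uniform convergence). -/
def CellCompactness : Prop := ApproxCellSeq → CellExists

/-- Assembly of D-A′: P1 → P2 → X⁻, PROVED (via the landed `stub_profileOfPolyhedralCell`). -/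
theorem X_of_palaisSmaleSplit (h₁ : ApproxCellSeq) (h₂ : CellCompactness) :
    PolyhedralDssProfileExists :=
  _root_.Summit.NavierStokesRegularity.NavierStokesRegularity.Theorems.PolyhedralDssProfileExists.PolyhedralCell.stub_profileOfPolyhedralCell
    (h₂ h₁)

/-- Converse bookkeeping: X⁻ ⇒ `CellExists` is the landed `polyhedralDssProfileExists_iff_cell` direction;
here we only record the trivial `CellExists → CellCompactness`, i.e. P2 is implied by the crux, so P2 is
never where the difficulty sits. -/
theorem cellCompactness_of_cellExists (h : CellExists) : CellCompactness := fun _ => h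

end Summit.NavierStokesRegularity.NavierStokesRegularity.Cruxes.PolyhedralDssProfileExists.S19g7
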